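import Literature.AnabelianGeometry.AbsoluteAnabelian.AbsTopIII.Thm19CuspidalDegree
import HarnessLib

/-!
# [AbsTopIII] Thm. 1.9 (c): cuspidal degree zero and `H¹(G_k, M_Z) ⊆ P_U` (proof-only companion)

Mochizuki, *Topics in Absolute Anabelian Geometry III*, §1, Prop. 1.6 (iii) p. 35 ("restricting
cohomology classes of `Π_U` to the various `I_x` [...] yields a natural exact sequence
`1 → (k^×)^∧ → H¹(Π_U, M_X) → ⊕_{x ∈ S} Ẑ`") and Thm. 1.9 (c) p. 37 ("the subgroup `P_U` [...] determined
by the cuspidal principal divisors via the isomorphisms of (b)").  Proof-only companion of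
`Thm19CuspidalDegree.lean` (sub-DAG `plan/L4/SUBDAG-AbsTopIII-Thm19.md`, row Thm19.c; cell abc-iut):

* `CurveModel.hasCuspidalDegree_zero_iff` — a class has cuspidal degree `0` at `z` (read through THE
  synchronization of (b)) iff its restriction to `I_z` vanishes (the class of the zero crossed
  homomorphism is zero, Literature `ContinuousCohomology.crossedHomClass_principal`);
* `CuspSyncPresentation.cuspidalDivisor_zero`, `DivisorCurveModel.isPrincipal_zero` (`div(1) = 0`);
* `IntrinsicKummerModel.galoisClasses_subset_PUgt` — **`H¹(G_k, M_Z) = Ker(res_{Δ_U}) ⊆ P_U^{gt}`**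
  (the `(k^×)^∧`-part of `P_U`), CONDITIONAL on abc-iut-L4-t1's named fact `Prop_1_6_iii_ker`
  (exactness of Prop. 1.6 (iii) in kernel form) — one of the two inclusions making up
  `PU ≤ PUgt` in `Thm19c` (the other, `κ_U(Γ(U, 𝒪^×)) ⊆ P_U^{gt}`, needs "`D ∘ κ_U = div`" read through the
  synchronizations, i.e. the Kummer/synchronization compatibility — see GAP-LEDGER G-w5d213-1).

All declarations are theorems; no new facts.  HONEST FRAMING: nothing here bears on [IUTchIII] Cor. 3.12.
-/

noncomputable section

open CategoryTheory
open scoped Classical Pointwise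

namespace Literature.AnabelianGeometry.AbsoluteAnabelian.AbsTopIII

universe u

/-- Congruence for `crossedHomClass` in the (dependently typed) pair `(f, hf)`.
[cite: MochizukiAbsTopIII2015, Prop 1.6 (iii) p.35] -/
theorem crossedHomClass_congr {G : Type u} [Group G] [TopologicalSpace G] [IsTopologicalGroup G]
    (X : TopRep.{u} ℤ G) {f f' : C(G, X)} (h : f = f')
    (hf : ∀ x y, f (x * y) = f x + X.ρ x (f y)) (hf' : ∀ x y, f' (x * y) = f' x + X.ρ x (f' y)) :
    ContinuousCohomology.crossedHomClass X f hf = ContinuousCohomology.crossedHomClass X f' hf' := by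
  subst h
  rfl

/-- The class of the ZERO crossed homomorphism vanishes. [cite: MochizukiAbsTopIII2015, Prop 1.6 (iii) p.35] -/
theorem crossedHomClass_zero {G : Type u} [Group G] [TopologicalSpace G] [IsTopologicalGroup G]
    (X : TopRep.{u} ℤ G) (f : C(G, X)) (h0 : ∀ g, f g = 0)
    (hf : ∀ x y, f (x * y) = f x + X.ρ x (f y)) :
    ContinuousCohomology.crossedHomClass X f hf = 0 := by
  have hv : Continuous fun g : G => X.ρ g (0 : X) := by
    simp only [map_zero]
    exact continuous_const
  have hfun : f = ⟨fun g => X.ρ g (0 : X) - 0, hv.sub continuous_const⟩ := by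
    ext g
    simp [h0 g]
  have hf' : ∀ x y, (⟨fun g => X.ρ g (0 : X) - 0, hv.sub continuous_const⟩ : C(G, X)) (x * y) =
      (⟨fun g => X.ρ g (0 : X) - 0, hv.sub continuous_const⟩ : C(G, X)) x +
        X.ρ x ((⟨fun g => X.ρ g (0 : X) - 0, hv.sub continuous_const⟩ : C(G, X)) y) := by
    intro x y
    simp
  rw [crossedHomClass_congr X hfun hf hf']
  exact ContinuousCohomology.crossedHomClass_principal X 0 hv hf'

namespace CurveModel

variable {M : CurveModel.{u}} {U Z : M.Curve} {h : M.IsCofiniteOpen U Z} (P : M.CuspSyncPresentation h)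

/-- **Cuspidal degree `0` at `z` ⟺ the restriction to `I_z` vanishes** (the degree being read through
THE synchronization of (b)). [cite: MochizukiAbsTopIII2015, Thm 1.9 (c) p.37] -/
theorem hasCuspidalDegree_zero_iff (η : cyclotomeModH1 (M.res h) ZHatCoeff.{u}) (z : (M.cusps U).Cusp) :
    HasCuspidalDegree P η z 0 ↔
      cyclotomeModH1Res (M.res h) ZHatCoeff.{u} ((M.cusps U).Icusp z) η = 0 := by
  have hc : Continuous fun i : (M.cusps U).Icusp z => (0 : ℤ) • P.syncAt z (Additive.ofMul i) := by
    simp only [zero_smul]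
    exact continuous_const
  have h0 : ∀ g, (⟨_, hc⟩ : C((M.cusps U).Icusp z, M.inertiaRep h z)) g = 0 := fun g => by
    simp
  have hf : ∀ x y : (M.cusps U).Icusp z,
      (⟨_, hc⟩ : C((M.cusps U).Icusp z, M.inertiaRep h z)) (x * y) =
        (⟨_, hc⟩ : C((M.cusps U).Icusp z, M.inertiaRep h z)) x +
          (M.inertiaRep h z).ρ x ((⟨_, hc⟩ : C((M.cusps U).Icusp z, M.inertiaRep h z)) y) := by
    intro x y
    rw [h0, h0, h0, map_zero, add_zero]
  constructor
  · rintro ⟨hc', hf', heq⟩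
    rw [heq]
    exact crossedHomClass_zero _ _ (fun g => by simp) hf'
  · intro hres
    refine ⟨hc, hf, ?_⟩
    rw [hres, crossedHomClass_zero _ _ h0 hf]

namespace CuspSyncPresentation

/-- The cuspidal divisor with all multiplicities `0` is `0`. [cite: MochizukiAbsTopIII2015, Thm 1.9 (c) p.37] -/
theorem cuspidalDivisor_zero : P.cuspidalDivisor (fun _ => 0) = 0 := by
  simp [cuspidalDivisor]

end CuspSyncPresentation

end CurveModel

namespace DivisorCurveModel

/-- `div(1) = 0`: the zero divisor is principal. [cite: MochizukiAbsTopIII2015, Prop 1.6 (ii) p.35] -/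
theorem isPrincipal_zero (M : DivisorCurveModel.{u}) (X : M.Curve) : M.IsPrincipal (0 : M.Point X →₀ ℤ) :=
  ⟨1, fun x => by simp⟩

end DivisorCurveModel

namespace IntrinsicKummerModel

variable (M : IntrinsicKummerModel.{u})

/-- **`H¹(G_k, M_Z) ⊆ P_U^{gt}`** (the Galois part of `P_U`, "`P_U ⋂ H¹(G_k, M_X) ≅ (k^×)^∧`"), for a
cofinite open `U ⊆ Z` as in (b) and any system of cyclotome presentations `P`, CONDITIONAL on
abc-iut-L4-t1's named fact `Prop_1_6_iii_ker` (a class with vanishing restriction to every `I_c` is a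
Galois class and conversely): Galois classes have cuspidal degree `0` everywhere, and the zero divisor is
principal.  One of the two inclusions of `PU ≤ PUgt` in `Thm19c`. [cite: MochizukiAbsTopIII2015, Thm 1.9 (c) p.37] -/
theorem galoisClasses_subset_PUgt (hker : M.Prop_1_6_iii_ker) {U Z : M.Curve} {h : M.IsCofiniteOpen U Z}
    (hZ : M.IsProper Z) (hU : M.IsScheme U) (hZs : M.IsScheme Z) (hg : 2 ≤ M.genus Z)
    (hk : IsKummerFaithful (M.base U)) (hrat : ∀ c : (M.cusps U).Cusp, (M.cusps U).IsRational c)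
    (P : M.toCurveModel.CuspSyncPresentation h) :
    (M.galoisClasses h : Set (cyclotomeModH1 (M.res h) ZHatCoeff.{u})) ⊆ M.PUgt P := by
  intro η hη
  refine ⟨fun _ => 0, fun z => ?_, ?_⟩
  · exact (CurveModel.hasCuspidalDegree_zero_iff P η z).2
      (((hker U Z h hZ hU hZs hg hk hrat η).2 hη) z)
  · rw [CurveModel.CuspSyncPresentation.cuspidalDivisor_zero]
    exact M.toDivisorCurveModel.isPrincipal_zero Z

end IntrinsicKummerModel

end Literature.AnabelianGeometry.AbsoluteAnabelian.AbsTopIII
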